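import Summits.ValiantsHypothesis.ValiantsHypothesis.Theorems.DepthWindowCarrierRefreshCore

/-!
# Route `DepthWindow` — the refresh level with a frozen carrier (either orientation)

Cone-free sequel of `DepthWindowCarrierRefreshCore.lean` (decomp-valiant lens 4, g16→g17) supporting the crux item
`HomImmHardTwoOne` (stmt-ValiantsHypothesis-30635): `exists_carrierRefresh` — the carrier refresh when ONE big side
of the working letters has mass `≤ M` (the count-minority side of the extraction does): orient the word so that the
lighter big side is positive and call the core lemma; with no big letter at all, every letter stays a singleton.

References: [LimayeSrinivasanTavenas2022] full version ECCC TR22-090, Lemma 21 / Algorithm 1, Prop. 17.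
-/

-- layout Summits/ValiantsHypothesis/ValiantsHypothesis forces the duplicated namespace component
set_option linter.dupNamespace false

namespace Summit.ValiantsHypothesis.ValiantsHypothesis.Theorems.DepthWindow.TreeBias

open Finset

variable {n : ℕ}

/-- **Carrier refresh (either orientation).**  If one big side of the working letters has mass `≤ M` (the
count-minority side of the extraction does), the refresh of the core lemma can be run after orienting the word
so that the LIGHTER big side is the positive one. [folklore] -/
theorem exists_carrierRefresh (z : Fin n → ℤ) (W : Finset (Fin n)) {v e M : ℕ}
    (hz : ∀ j ∈ W, |z j| ≤ v)
    (hmin : ∑ j ∈ W.filter (fun j => (e : ℤ) < z j), z j ≤ M ∨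
      -(∑ j ∈ W.filter (fun j => z j < -(e : ℤ)), z j) ≤ M) :
    ∃ L : Fin n → Fin n, (∀ i, L (L i) = L i) ∧
      (∀ i, i ∉ W → ∀ j, L j = i ↔ j = i) ∧
      (∀ i ∈ W, ∑ j ∈ univ.filter (fun j => L j = L i), |z j| ≤ 2 * M + 2 * v) ∧
      (∀ i ∈ W, |∑ j ∈ univ.filter (fun j => L j = L i), z j| ≤ v) ∧
      (∑ i ∈ univ.filter (fun i => i ∈ W ∧ L i = i ∧
          (e : ℤ) < |∑ j ∈ univ.filter (fun j => L j = i), z j|),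
          |∑ j ∈ univ.filter (fun j => L j = i), z j|) +
        |∑ j ∈ W, z j - ∑ i ∈ univ.filter (fun i => i ∈ W ∧ L i = i ∧
          (e : ℤ) < |∑ j ∈ univ.filter (fun j => L j = i), z j|),
          ∑ j ∈ univ.filter (fun j => L j = i), z j| ≤ |∑ j ∈ W, z j| := by
  classical
  have hM0 : (0 : ℤ) ≤ M := Nat.cast_nonneg M
  rcases (W.filter (fun j => (e : ℤ) < z j) ∪ W.filter (fun j => z j < -(e : ℤ))).eq_empty_or_nonempty
    with hPN | hPN
  · -- no working letter above the precision: everybody is a singleton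
    have hsmall : ∀ j ∈ W, |z j| ≤ e := by
      intro j hjW
      have h1 : j ∉ W.filter (fun j => (e : ℤ) < z j) := fun h => by
        have : j ∈ W.filter (fun j => (e : ℤ) < z j) ∪ W.filter (fun j => z j < -(e : ℤ)) := mem_union_left _ h
        rw [hPN] at this; simp at this
      have h2 : j ∉ W.filter (fun j => z j < -(e : ℤ)) := fun h => by
        have : j ∈ W.filter (fun j => (e : ℤ) < z j) ∪ W.filter (fun j => z j < -(e : ℤ)) := mem_union_right _ h
        rw [hPN] at this; simp at this
      rw [mem_filter, not_and, not_lt] at h1 h2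
      exact abs_le.2 ⟨h2 hjW, h1 hjW⟩
    have hfid : ∀ i : Fin n, univ.filter (fun j => (id j : Fin n) = id i) = {i} := by intro i; ext j; simp
    have hfid' : ∀ i : Fin n, univ.filter (fun j => (id j : Fin n) = i) = {i} := by intro i; ext j; simp
    refine ⟨id, fun i => rfl, fun i _ j => Iff.rfl, fun i hi => ?_, fun i hi => ?_, ?_⟩
    · rw [hfid, sum_singleton]
      have := hz i hi; have := abs_nonneg (z i); have := (Nat.cast_nonneg v : (0 : ℤ) ≤ v); linarith
    · rw [hfid, sum_singleton]; exact hz i hi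
    · have : univ.filter (fun i => i ∈ W ∧ (id i : Fin n) = i ∧
          (e : ℤ) < |∑ j ∈ univ.filter (fun j => (id j : Fin n) = i), z j|) = ∅ := by
        refine filter_false_of_mem fun i _ => ?_
        rw [hfid' i, sum_singleton]
        exact fun h => not_lt.2 (hsmall i h.1) h.2.2
      rw [this, sum_empty, sum_empty, sub_zero, zero_add]
  by_cases hc : ∑ j ∈ W.filter (fun j => (e : ℤ) < z j), z j +
      ∑ j ∈ W.filter (fun j => z j < -(e : ℤ)), z j ≤ 0
  · refine exists_carrierRefresh_core z W hz ?_ hc hPN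
    rcases hmin with h1 | h1
    · exact h1
    · linarith
  · rw [not_le] at hc
    have hz' : ∀ j ∈ W, |(-z j)| ≤ v := fun j hj => by rw [abs_neg]; exact hz j hj
    have hf1 : W.filter (fun j => (e : ℤ) < -z j) = W.filter (fun j => z j < -(e : ℤ)) := by
      ext j; simp only [mem_filter]; constructor <;> rintro ⟨h1, h2⟩ <;> exact ⟨h1, by linarith⟩
    have hf2 : W.filter (fun j => -z j < -(e : ℤ)) = W.filter (fun j => (e : ℤ) < z j) := by
      ext j; simp only [mem_filter]; constructor <;> rintro ⟨h1, h2⟩ <;> exact ⟨h1, by linarith⟩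
    have hQ' : ∑ j ∈ W.filter (fun j => (e : ℤ) < -z j), -z j ≤ M := by
      rw [hf1, sum_neg_distrib]
      rcases hmin with h1 | h1
      · linarith
      · exact h1
    have hQQ' : ∑ j ∈ W.filter (fun j => (e : ℤ) < -z j), -z j +
        ∑ j ∈ W.filter (fun j => -z j < -(e : ℤ)), -z j ≤ 0 := by
      rw [hf1, hf2, sum_neg_distrib, sum_neg_distrib]; linarith
    have hPN' : (W.filter (fun j => (e : ℤ) < -z j) ∪ W.filter (fun j => -z j < -(e : ℤ))).Nonempty := by
      rw [hf1, hf2, union_comm]; exact hPN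
    obtain ⟨L, hidem, hout, hmass, hval, hover⟩ :=
      exists_carrierRefresh_core (fun j => -z j) W hz' hQ' hQQ' hPN'
    have hSt : univ.filter (fun i => i ∈ W ∧ L i = i ∧
        (e : ℤ) < |∑ j ∈ univ.filter (fun j => L j = i), -z j|) =
        univ.filter (fun i => i ∈ W ∧ L i = i ∧ (e : ℤ) < |∑ j ∈ univ.filter (fun j => L j = i), z j|) := by
      ext i; simp only [mem_filter, mem_univ, true_and, sum_neg_distrib, abs_neg]
    refine ⟨L, hidem, hout, fun i hi => ?_, fun i hi => ?_, ?_⟩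
    · simpa only [abs_neg] using hmass i hi
    · simpa only [sum_neg_distrib, abs_neg] using hval i hi
    · rw [hSt] at hover
      simp only [sum_neg_distrib, abs_neg] at hover
      have key : ∀ a b : ℤ, |-a - -b| = |a - b| := fun a b => by
        rw [show -a - -b = -(a - b) by ring, abs_neg]
      rw [key] at hover
      exact hover

end Summit.ValiantsHypothesis.ValiantsHypothesis.Theorems.DepthWindow.TreeBias
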